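import Summits.CriticalPhenomena.PercolationContinuityZ3.Theorems.PercNearOneGluingNoHeavyLowerTailSahiE3MajPattern
import Summits.CriticalPhenomena.PercolationContinuityZ3.Theorems.PercNearOneGluingNoHeavyLowerTailSahiE3MajPatternFacts
import Summits.CriticalPhenomena.PercolationContinuityZ3.Theorems.PercNearOneGluingNoHeavyLowerTailSahiE3MajCore
import Summits.CriticalPhenomena.PercolationContinuityZ3.Theorems.PercNearOneGluingNoHeavyLowerTailSahiE3PatternCertificate
import Summits.CriticalPhenomena.PercolationContinuityZ3.Theorems.PercNearOneGluingNoHeavyLowerTailSahiE3TwoPrimeSlot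
import Literature.Combinatorics.Sahi2008.Percolation
import Mathlib.Data.Fin.VecNotation
import Mathlib.Tactic.FinCases
import HarnessLib
import HarnessLib.Audit

/-!
# `NoHeavyLowerTail` (crux stmt-CriticalPhenomena-4575), Sahi programme P4 (Holley / monotone coupling):
# FKG slot-locality for the MAJORITY OF THREE JOIN-PRIMES — the maj-slot theorem

Support file (cell `prim-l12`, seat P4, generation 9; `--supports stmt-CriticalPhenomena-4575`).  No named facts, no sorries; standard
axioms; def-free.

THEOREM (`latticeE3_nonneg_of_maj`).  For every finite distributive lattice `L`, every nonnegative log-supermodular weight `μ` (an FKG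
measure, zeros allowed, not normalised), up-sets `A, B ⊆ L` and join-prime `j₁, j₂, j₃`:
`0 ≤ latticeE3 μ (↑(j₁⊔j₂) ∪ ↑(j₁⊔j₃) ∪ ↑(j₂⊔j₃)) A B`,
i.e. Sahi's third-order inequality `C₃` holds for the triple (`{x | at least two of j₁, j₂, j₃ lie below x}`, `A`, `B`).  On a Boolean lattice
`2^ι` (`latticeE3_nonneg_maj_cube`): the slot "ω contains at least two of `a, b, c`" with `A, B` arbitrary increasing events, for every
log-supermodular weight.  This is the FKG-measure counterpart, for the majority pattern, of the product-measure hitting-slot theorems; with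
`…SahiE3TwoPrimeSlot` (slot `↑j₁ ∪ ↑j₂`) and `…SahiE3FilterRestriction` it settles, on the `k = 5` residual atlas of the programme,
the 46 tri-saturated orbits whose slot has the reduced pattern `12+13+23` (among them hard-core orbits 72, 445, 883 of the ttrl census;
HOME prim-l12-p4/STATUS.md).

PROOF.  `…SahiE3PatternCertificate.latticeE3_nonneg_of_patternCertificate` (generation 8) reduces the claim to a FLOW CERTIFICATE for the
pattern measure `ν` of `x ↦ (jᵢ ≤ x)_i` on `2³` with slot set `MAJ = {110, 101, 011, 111}`; `…SahiE3MajPattern.certificate_of_ineqs` reduces the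
certificate to 47 real inequalities on the eight fibre masses; `…SahiE3MajPatternFacts.facts_of_pattern` derives the consequences of
log-supermodularity of `ν` (one Ahlswede–Daykin inequality across fibres, `fib_ad`); `…SahiE3MajCore.exists_cert` produces the retained
masses in four regimes (memo HOME prim-l12-p4/FROM-prim-l12-p4-gen8-PATTERN-CERTIFICATES.md §4b; machine-certified real algebra).  This file
only identifies the preimage of `MAJ` with the slot.  Corollaries: join-irreducible generators, the other two slots, Sahi's `E₃` for FKG
probability weights, Boolean lattices.
-/

namespace Summit.CriticalPhenomena.PercolationContinuityZ3.Theorems.SahiE3MajSlot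

open Finset Literature.Probability.LatticeModels
open scoped BigOperators

variable {α : Type*} [DistribLattice α] [Fintype α] [DecidableEq α] [DecidableLE α]

/-- **FKG slot-locality for the majority of three join-primes (the maj-slot theorem).**  For every nonnegative log-supermodular
weight `μ` on a finite distributive lattice, up-sets `A, B` and join-prime `j₁, j₂, j₃`:
`0 ≤ latticeE3 μ (↑(j₁⊔j₂) ∪ ↑(j₁⊔j₃) ∪ ↑(j₂⊔j₃)) A B` — Sahi's `C₃` for the triple
(`{x | at least two of j₁, j₂, j₃ lie below x}`, `A`, `B`). [this work] -/
theorem latticeE3_nonneg_of_maj {μ : α → ℝ} (hμ₀ : 0 ≤ μ) (hμ : ∀ a b, μ a * μ b ≤ μ (a ⊓ b) * μ (a ⊔ b))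
    {j₁ j₂ j₃ : α} (hj₁ : SupPrime j₁) (hj₂ : SupPrime j₂) (hj₃ : SupPrime j₃) {A B : Finset α}
    (hA : IsUpperSet (A : Set α)) (hB : IsUpperSet (B : Set α)) :
    0 ≤ latticeE3 μ (principalUp (j₁ ⊔ j₂) ∪ principalUp (j₁ ⊔ j₃) ∪ principalUp (j₂ ⊔ j₃)) A B := by
  -- the pattern map of the three join-primes
  set j : Fin 3 → α := ![j₁, j₂, j₃] with hjdef
  have hj : ∀ i, SupPrime (j i) := by
    intro i; fin_cases i
    · exact hj₁
    · exact hj₂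
    · exact hj₃
  set F : (Fin 3 → Bool) → Finset α := fun t => univ.filter fun x => ∀ i, (j i ≤ x ↔ t i = true) with hFdef
  have hF : ∀ (t : Fin 3 → Bool) (x : α), x ∈ F t ↔ ∀ i, (j i ≤ x ↔ t i = true) := by
    intro t x; simp [hFdef]
  set ν : (Fin 3 → Bool) → ℝ := fun t => mass μ (F t) with hνdef
  have hν0 : ∀ t, 0 ≤ ν t := fun t => mass_nonneg hμ₀ _
  have hU : IsUpperSet ((univ : Finset α) : Set α) := fun _ _ _ _ => Finset.mem_univ _
  have hν : ∀ s t, ν s * ν t ≤ ν (s ⊓ t) * ν (s ⊔ t) := by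
    intro s t
    have h := SahiE3HitSlotCertificate.fib_ad hμ₀ hμ hj hF hU hU s t
    simpa only [Finset.univ_inter] using h
  -- the facts, the certificate data, the certificate
  obtain ⟨f1, f2, f3, f4, f5, f6, f7, f8, f9, f10, -, -, -, -, -, -, f17, f18, f19, f20, f21, f22, f23, f24, f25, f26, f27, f28, f29, f30, f31⟩ :=
    SahiE3MajPattern.facts_of_pattern ν hν0 hν _ _ _ _ _ _ _ _ _ rfl rfl rfl rfl rfl rfl rfl rfl rfl
  obtain ⟨r01, r02, r12, rT, H⟩ := SahiE3MajCert.exists_cert _ _ _ _ _ _ _ _ _ f1 f2 f3 f4 f5 f6 f7 f8 f9 f10 f17 f18 f19 f20 f21 f22 f23 f24 f25 f26 f27 f28 f29 f30 f31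
  obtain ⟨R, Fl, h1, h2, h3, h4, h5, h6⟩ :=
    SahiE3MajPattern.certificate_of_ineqs _ rfl ν hν0 hν _ _ _ _ _ _ _ _ _ rfl rfl rfl rfl rfl rfl rfl rfl rfl r01 r02 r12 rT H
  have key := SahiE3PatternCertificate.latticeE3_nonneg_of_patternCertificate hμ₀ hμ hj hF hA hB _ ν (fun t => rfl) R Fl
    h1 h2 h3 h4 h5 h6
  -- identify the slot
  have hslot : (univ.filter fun x : α => (fun i => decide (j i ≤ x)) ∈
      ({![true, true, false], ![true, false, true], ![false, true, true], ![true, true, true]} : Finset (Fin 3 → Bool))) =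
      principalUp (j₁ ⊔ j₂) ∪ principalUp (j₁ ⊔ j₃) ∪ principalUp (j₂ ⊔ j₃) := by
    ext x
    simp only [Finset.mem_filter, Finset.mem_univ, true_and, Finset.mem_union, mem_principalUp, sup_le_iff,
      Finset.mem_insert, Finset.mem_singleton, funext_iff, Fin.forall_fin_succ, Fin.forall_fin_zero, hjdef,
      Matrix.cons_val_zero, Matrix.cons_val_succ, Matrix.cons_val_fin_one, decide_eq_true_eq, decide_eq_false_iff_not,
      and_true]
    tauto
  rw [hslot] at key
  exact key

/-- The same with join-IRREDUCIBLE `j₁, j₂, j₃` (equivalent to join-prime on a distributive lattice). [this work] -/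
theorem latticeE3_nonneg_of_maj_supIrred {μ : α → ℝ} (hμ₀ : 0 ≤ μ) (hμ : ∀ a b, μ a * μ b ≤ μ (a ⊓ b) * μ (a ⊔ b))
    {j₁ j₂ j₃ : α} (hj₁ : SupIrred j₁) (hj₂ : SupIrred j₂) (hj₃ : SupIrred j₃) {A B : Finset α}
    (hA : IsUpperSet (A : Set α)) (hB : IsUpperSet (B : Set α)) :
    0 ≤ latticeE3 μ (principalUp (j₁ ⊔ j₂) ∪ principalUp (j₁ ⊔ j₃) ∪ principalUp (j₂ ⊔ j₃)) A B :=
  latticeE3_nonneg_of_maj hμ₀ hμ hj₁.supPrime hj₂.supPrime hj₃.supPrime hA hB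

/-- The majority slot in the second position. [this work] -/
theorem latticeE3_nonneg_of_maj₂ {μ : α → ℝ} (hμ₀ : 0 ≤ μ) (hμ : ∀ a b, μ a * μ b ≤ μ (a ⊓ b) * μ (a ⊔ b))
    {j₁ j₂ j₃ : α} (hj₁ : SupPrime j₁) (hj₂ : SupPrime j₂) (hj₃ : SupPrime j₃) {A B : Finset α}
    (hA : IsUpperSet (A : Set α)) (hB : IsUpperSet (B : Set α)) :
    0 ≤ latticeE3 μ A (principalUp (j₁ ⊔ j₂) ∪ principalUp (j₁ ⊔ j₃) ∪ principalUp (j₂ ⊔ j₃)) B := by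
  rw [SahiC3Cube.latticeE3_comm₁₂]; exact latticeE3_nonneg_of_maj hμ₀ hμ hj₁ hj₂ hj₃ hA hB

/-- The majority slot in the third position. [this work] -/
theorem latticeE3_nonneg_of_maj₃ {μ : α → ℝ} (hμ₀ : 0 ≤ μ) (hμ : ∀ a b, μ a * μ b ≤ μ (a ⊓ b) * μ (a ⊔ b))
    {j₁ j₂ j₃ : α} (hj₁ : SupPrime j₁) (hj₂ : SupPrime j₂) (hj₃ : SupPrime j₃) {A B : Finset α}
    (hA : IsUpperSet (A : Set α)) (hB : IsUpperSet (B : Set α)) :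
    0 ≤ latticeE3 μ A B (principalUp (j₁ ⊔ j₂) ∪ principalUp (j₁ ⊔ j₃) ∪ principalUp (j₂ ⊔ j₃)) := by
  rw [SahiC3Cube.latticeE3_comm₁₃]; exact latticeE3_nonneg_of_maj hμ₀ hμ hj₁ hj₂ hj₃ hB hA

open Literature.Combinatorics.Sahi2008 in
/-- **Sahi's `E₃(1_{↑(j₁⊔j₂) ∪ ↑(j₁⊔j₃) ∪ ↑(j₂⊔j₃)}, 1_A, 1_B) ≥ 0` for every FKG probability weight** on a finite distributive lattice
(the `n = 3` functional of the tree's `SahiConjecture`, Literature `sahiE μ 3`), `A, B` increasing events, `j₁, j₂, j₃` join-prime.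
[this work] -/
theorem sahiE_three_nonneg_of_maj {μ : α → ℝ} (hμ : IsFKGMeasure μ) {j₁ j₂ j₃ : α} (hj₁ : SupPrime j₁) (hj₂ : SupPrime j₂)
    (hj₃ : SupPrime j₃) {A B : Finset α} (hA : IsUpperSet (A : Set α)) (hB : IsUpperSet (B : Set α)) :
    0 ≤ sahiE μ 3 ![setInd (principalUp (j₁ ⊔ j₂) ∪ principalUp (j₁ ⊔ j₃) ∪ principalUp (j₂ ⊔ j₃)), setInd A, setInd B] := by
  rw [sahiE_three_indicator_eq_latticeE3 hμ.sum_eq_one]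
  exact latticeE3_nonneg_of_maj hμ.nonneg hμ.mul_le_mul hj₁ hj₂ hj₃ hA hB

/-! ### Boolean lattices: the slot "`ω` contains at least two of `a, b, c`" -/

section Boolean

variable {ι : Type*} [Fintype ι] [DecidableEq ι]

/-- `↑{a,b} ∪ ↑{a,c} ∪ ↑{b,c} = {ω | two of a, b, c lie in ω}` in `Finset ι`. [this work] -/
theorem principalUp_pairs_union (a b c : ι) :
    principalUp (({a} : Finset ι) ⊔ {b}) ∪ principalUp (({a} : Finset ι) ⊔ {c}) ∪ principalUp (({b} : Finset ι) ⊔ {c}) =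
      univ.filter fun ω : Finset ι => (a ∈ ω ∧ b ∈ ω) ∨ (a ∈ ω ∧ c ∈ ω) ∨ (b ∈ ω ∧ c ∈ ω) := by
  ext ω
  simp [mem_principalUp, Finset.insert_subset_iff]

/-- **Sahi's `C₃` on `2^ι` for every FKG weight when one slot is "`ω` contains at least two of `a, b, c`"**, the other two slots
arbitrary up-sets: the FKG-measure counterpart, for the majority pattern, of the product-measure hitting-slot theorems. [this work] -/
theorem latticeE3_nonneg_maj_cube {μ : Finset ι → ℝ} (hμ₀ : 0 ≤ μ) (hμ : ∀ a b, μ a * μ b ≤ μ (a ⊓ b) * μ (a ⊔ b))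
    (a b c : ι) {A B : Finset (Finset ι)} (hA : IsUpperSet (A : Set (Finset ι))) (hB : IsUpperSet (B : Set (Finset ι))) :
    0 ≤ latticeE3 μ (univ.filter fun ω : Finset ι => (a ∈ ω ∧ b ∈ ω) ∨ (a ∈ ω ∧ c ∈ ω) ∨ (b ∈ ω ∧ c ∈ ω)) A B := by
  rw [← principalUp_pairs_union]
  exact latticeE3_nonneg_of_maj hμ₀ hμ (SahiE3CovHit.supPrime_singleton' a) (SahiE3CovHit.supPrime_singleton' b)
    (SahiE3CovHit.supPrime_singleton' c) hA hB

end Boolean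

/-! ### Kahn's Conjecture 5 (product measures on `Set ι`) for the slot "at least two of `a, b, c` are open" -/

section Kahn

open MeasureTheory Literature.Combinatorics.Sahi2008 Literature.Probability.Percolation

variable {ι : Type*} [Fintype ι]

omit [Fintype ι] in
/-- Singletons are join-prime in the Boolean lattice `Set ι`. [folklore] -/
theorem supPrime_set_singleton (a : ι) : SupPrime ({a} : Set ι) := by
  refine ⟨fun h => ?_, fun x y hxy => ?_⟩
  · exact Set.singleton_ne_empty a (le_bot_iff.1 (h (bot_le (a := ({a} : Set ι)))))
  · simpa [Set.singleton_subset_iff] using hxy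

/-- **Kahn's Conjecture 5 holds whenever one of the three increasing events is "at least two of the coordinates `a, b, c` are
open"**, for every finite index type, every `p : ι → [0,1]` and ALL increasing `A, B ⊆ Set ι`:
`0 ≤ sahiE3 (prodBernoulli p) {ω | (a ∈ ω ∧ b ∈ ω) ∨ (a ∈ ω ∧ c ∈ ω) ∨ (b ∈ ω ∧ c ∈ ω)} A B` (the maj-slot theorem for the log-modular
product weight `bernoulliWeight p` on the lattice `Set ι`, via `Literature…sahiE_three_ind`). [this work] -/
theorem kahn_of_maj (p : ι → unitInterval) (a b c : ι) {A B : Set (Set ι)} (hA : IsUpperSet A) (hB : IsUpperSet B) :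
    0 ≤ Literature.Probability.LatticeModels.sahiE3 (prodBernoulli p)
      {ω : Set ι | (a ∈ ω ∧ b ∈ ω) ∨ (a ∈ ω ∧ c ∈ ω) ∨ (b ∈ ω ∧ c ∈ ω)} A B := by
  classical
  rw [← sahiE_three_ind]
  have hμ := isFKGMeasure_bernoulliWeight p
  have hA' : IsUpperSet ((A.toFinset : Finset (Set ι)) : Set (Set ι)) := by simpa using hA
  have hB' : IsUpperSet ((B.toFinset : Finset (Set ι)) : Set (Set ι)) := by simpa using hB
  have key := sahiE_three_nonneg_of_maj hμ (supPrime_set_singleton a) (supPrime_set_singleton b)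
    (supPrime_set_singleton c) hA' hB'
  refine le_of_le_of_eq key ?_
  congr 1
  funext i
  fin_cases i
  · funext ω
    by_cases h1 : a ∈ ω <;> by_cases h2 : b ∈ ω <;> by_cases h3 : c ∈ ω <;>
      simp [setInd_apply, DecisionTree.ind, mem_principalUp, Set.insert_subset_iff, h1, h2, h3]
  · funext ω
    simp [setInd_apply, DecisionTree.ind]
  · funext ω
    simp [setInd_apply, DecisionTree.ind]

end Kahn

end Summit.CriticalPhenomena.PercolationContinuityZ3.Theorems.SahiE3MajSlot
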